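import Summits.NavierStokesRegularity.NavierStokesRegularity.Theorems.EfficiencyFloorProductionEfficiencyDecayTypeIRecurrence
import HarnessLib

/-!
# Density of growth instants under a Type-I enstrophy bound (line `efficiency_floor`, crux
# `EfficiencyFloor.ProductionEfficiencyDecay`, stmt-NavierStokesRegularity-22866; `--supports`)

Quantitative form of `Theorems/EfficiencyFloorProductionEfficiencyDecayTypeIRecurrence.lean`. There the
mean value theorem produced ONE growth instant `Ż ≥ Z³/(4W²)` after every late time `t` with
`Z(t) ≤ W/√(T−t)`. Here the Lu–Doering cubic law `2Ż/Z³ ≤ 27c⁴/(64ν³)` (tools file, `cubic_law`) and the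
fundamental theorem of calculus in inequality form (Mathlib
`intervalIntegral.sub_le_integral_of_hasDeriv_right_of_le`, no integrability of `Ż` needed) give a
MEASURE bound: the growth instants in `(t,T)` occupy at least the fraction `κ = 32ν³/(27c⁴W²)` of the
remaining lifetime `T − t` (`TypeIRecurrence.density`). In words: a blow-up at Leray's enstrophy rate must
spend a fixed positive fraction of every late interval `[t,T)` in cubic-rate growth — hence (previous
file, `concentrated_of_growth`) in concentrated near-extremal states (`density_concentrated`,
`density_of_quarterLaw`). The real-analysis core is `measure_growthSet_ge`.

READ-OUT FOR THE LINE: the floor `Z√(T−t) → ∞` that the route's deciding theorem consumes is EQUIVALENT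
to the failure, for every `W`, of the hypothesis `Z(t) ≤ W/√(T−t) frequently`; by `density` a sufficient
condition is that the growth instants have upper density `→ 0` at `T` — strictly weaker than the pointwise
crux-proper stub S2 (no growth instants at all near `T`).

HONEST FRAMING: structure theorems about a HYPOTHETICAL maximal solution of finite lifespan; the crux is
NOT proved; NS regularity is NOT proved by anything here; no summit is claimed. [folklore]
-/

-- the problem directory repeats the summit name (`NavierStokesRegularity/NavierStokesRegularity`)
set_option linter.dupNamespace false

noncomputable section

open Set Filter MeasureTheory Topology
open scoped InnerProductSpace ENNReal NNReal
open Literature.Analysis.FluidPDE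

namespace Summit.NavierStokesRegularity.NavierStokesRegularity.Theorems

namespace TypeIRecurrence

/-! ## 1. Real analysis: the measure of the growth set -/

/-- **Measure of the growth set.** Let `G` be differentiable on `[t,T)` with derivative `f ≤ M` (`M > 0`),
and suppose `G` gets above `−η` somewhere in `(t,T)` for every `η > 0`. Then for `λ ≥ 0` the set of
`s ∈ (t,T)` with `f(s) ≥ λ` has measure at least `(−G(t) − λ(T−t))/M`: the fundamental theorem of calculus
in inequality form against the integrable majorant `λ + (M−λ)·𝟙_{f ≥ λ}` of `f`. [folklore] -/
theorem measure_growthSet_ge {G f : ℝ → ℝ} {t T M lam : ℝ}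
    (hder : ∀ s ∈ Ico t T, HasDerivAt G (f s) s) (hM : ∀ s ∈ Ico t T, f s ≤ M) (hM0 : 0 < M)
    (hlam : 0 ≤ lam) (hsup : ∀ η : ℝ, 0 < η → ∃ T' ∈ Ioo t T, -η ≤ G T') :
    ENNReal.ofReal ((-G t - lam * (T - t)) / M) ≤ volume {s | s ∈ Ioo t T ∧ lam ≤ f s} := by
  set A : Set ℝ := {s | s ∈ Ioo t T ∧ lam ≤ f s} with hA
  -- `A` is measurable: on `(t,T)`, `f = deriv G`
  have hAeq : A = Ioo t T ∩ {s | lam ≤ deriv G s} := by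
    ext s
    simp only [hA, mem_setOf_eq, mem_inter_iff]
    constructor
    · rintro ⟨hs, hle⟩
      exact ⟨hs, by rwa [(hder s ⟨hs.1.le, hs.2⟩).deriv]⟩
    · rintro ⟨hs, hle⟩
      exact ⟨hs, by rwa [(hder s ⟨hs.1.le, hs.2⟩).deriv] at hle⟩
  have hAm : MeasurableSet A := by
    rw [hAeq]
    exact measurableSet_Ioo.inter (measurableSet_le measurable_const (measurable_deriv G))
  have hAsub : A ⊆ Ioo t T := fun s hs => hs.1
  have hAfin : volume A ≠ ⊤ :=
    ((measure_mono hAsub).trans_lt (by rw [Real.volume_Ioo]; exact ENNReal.ofReal_lt_top)).ne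
  set a : ℝ := (volume A).toReal with ha
  have ha0 : 0 ≤ a := ENNReal.toReal_nonneg
  rw [← ENNReal.ofReal_toReal hAfin]
  refine ENNReal.ofReal_le_ofReal ?_
  rw [div_le_iff₀ hM0]
  -- `−G(t) ≤ λ(T−t) + M·a + η` for every `η > 0`
  have hkey : ∀ η : ℝ, 0 < η → -G t ≤ lam * (T - t) + M * a + η := by
    intro η hη
    obtain ⟨T', hT', hGT'⟩ := hsup η hη
    have htT' : t ≤ T' := hT'.1.le
    -- the majorant
    set φ : ℝ → ℝ := fun s => lam + A.indicator (fun _ => M - lam) s with hφ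
    have hcont : ContinuousOn G (Icc t T') := fun s hs =>
      (hder s ⟨hs.1, hs.2.trans_lt hT'.2⟩).continuousAt.continuousWithinAt
    have hderiv : ∀ s ∈ Ioo t T', HasDerivWithinAt G (f s) (Ioi s) s := fun s hs =>
      (hder s ⟨hs.1.le, hs.2.trans hT'.2⟩).hasDerivWithinAt
    have hIcc : volume (Icc t T') ≠ ⊤ := by rw [Real.volume_Icc]; exact ENNReal.ofReal_ne_top
    have hφint : IntegrableOn φ (Icc t T') volume := by
      refine IntegrableOn.add ?_ ?_
      · exact integrableOn_const hIcc
      · exact (integrableOn_const hIcc).indicator hAm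
    have hφg : ∀ s ∈ Ioo t T', f s ≤ φ s := by
      intro s hs
      have hsI : s ∈ Ico t T := ⟨hs.1.le, hs.2.trans hT'.2⟩
      by_cases hsA : s ∈ A
      · simp only [hφ, indicator_of_mem hsA]
        linarith [hM s hsI]
      · simp only [hφ, indicator_of_notMem hsA, add_zero]
        have : ¬ (lam ≤ f s) := fun h => hsA ⟨⟨hs.1, hs.2.trans hT'.2⟩, h⟩
        exact (not_le.1 this).le
    have hFTC := intervalIntegral.sub_le_integral_of_hasDeriv_right_of_le htT' hcont hderiv hφint hφg
    -- evaluate the integral of the majorant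
    have hint : ∫ y in t..T', φ y = lam * (T' - t) + (volume (Ioc t T' ∩ A)).toReal * (M - lam) := by
      rw [intervalIntegral.integral_of_le htT']
      have hIoc : volume (Ioc t T') ≠ ⊤ := by rw [Real.volume_Ioc]; exact ENNReal.ofReal_ne_top
      have h1 : IntegrableOn (fun _ : ℝ => lam) (Ioc t T') volume := integrableOn_const hIoc
      have h2 : IntegrableOn (A.indicator fun _ : ℝ => M - lam) (Ioc t T') volume :=
        (integrableOn_const hIoc).indicator hAm
      rw [integral_add h1 h2, setIntegral_const, setIntegral_indicator hAm, setIntegral_const]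
      simp only [measureReal_def, Real.volume_Ioc, ENNReal.toReal_ofReal (sub_nonneg.2 htT'),
        smul_eq_mul]
      ring
    -- bound it by `λ(T−t) + M a`
    have hv : (volume (Ioc t T' ∩ A)).toReal ≤ a :=
      ENNReal.toReal_mono hAfin (measure_mono inter_subset_right)
    have hv0 : 0 ≤ (volume (Ioc t T' ∩ A)).toReal := ENNReal.toReal_nonneg
    have hbound : ∫ y in t..T', φ y ≤ lam * (T - t) + M * a := by
      rw [hint]
      have h3 : lam * (T' - t) ≤ lam * (T - t) := mul_le_mul_of_nonneg_left (by linarith [hT'.2]) hlam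
      nlinarith [mul_le_mul_of_nonneg_left hv hM0.le, mul_nonneg hlam hv0]
    linarith [hFTC, hbound, hGT']
  have := le_of_forall_pos_le_add (a := -G t) (b := lam * (T - t) + M * a) fun η hη => hkey η hη
  linarith

/-! ## 2. Along a maximal smooth Leray–Hopf solution -/

variable {ν T : ℝ} {u : ℝ → EuclideanSpace ℝ (Fin 3) → EuclideanSpace ℝ (Fin 3)}
  {p : ℝ → EuclideanSpace ℝ (Fin 3) → ℝ}

/-- **Density of growth instants under a Type-I enstrophy bound.** Along a maximal smooth Leray–Hopf
rapidly-decaying-datum solution with budget `(Z, Pal, S)` and envelope constant `c` (stmt-22995):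
eventually, at every time `t` with `Z(t) ≤ W/√(T−t)`, the set of later times `s ∈ (t,T)` of cubic-rate
growth `Z(s)³/(4W²) ≤ Ż(s) = 2S − 2ν·Pal` has Lebesgue measure at least `(32ν³/(27c⁴W²))·(T − t)`.
[folklore] -/
theorem density (hν : 0 < ν) (hT : 0 < T) (hmax : IsMaximalSmoothSolution ν 0 u p T)
    (hLH : IsLerayHopfOn T ν 0 (u 0) u) (hdec : HasRapidSpatialDecay (u 0)) {c : ℝ} (hc : 0 < c)
    {Zr Pr Sr : ℝ → ℝ}
    (hZ : ∀ t ∈ Set.Ioo 0 T,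
      ∫⁻ x, ‖curl (u t) x‖ₑ ^ 2 = ENNReal.ofReal (Zr t) ∧ 0 ≤ Zr t ∧ 0 ≤ Pr t ∧
      Pr t = ∫ x, frobeniusNormSq (fderiv ℝ (curl (u t)) x) ∧
      Sr t = ∫ x, ⟪curl (u t) x, fderiv ℝ (u t) x (curl (u t) x)⟫_ℝ ∧
      HasDerivAt Zr (2 * Sr t - 2 * ν * Pr t) t ∧
      |Sr t| ≤ c * Zr t ^ (3 / 4 : ℝ) * Pr t ^ (3 / 4 : ℝ))
    {W : ℝ} (hW : 0 < W) :
    ∀ᶠ t in 𝓝[<] T, ∫⁻ x, ‖curl (u t) x‖ₑ ^ 2 ≤ ENNReal.ofReal (W / Real.sqrt (T - t)) →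
      ENNReal.ofReal (32 * ν ^ 3 / (27 * c ^ 4 * W ^ 2) * (T - t)) ≤
        volume {s | s ∈ Ioo t T ∧ 0 < Zr s ∧ Zr s ^ 3 / (4 * W ^ 2) ≤ 2 * Sr s - 2 * ν * Pr s} := by
  -- a late window on which `Z ≥ 1`
  obtain ⟨t₁, ht₁T, ht₁⟩ := mem_nhdsLT_iff_exists_Ioo_subset.1
    (eventually_le_Zr hν hT hmax hLH hdec (fun t ht => (hZ t ht).1) (fun t ht => (hZ t ht).2.1) 1)
  filter_upwards [Ioo_mem_nhdsLT ht₁T] with t ht hbound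
  have htT : t < T := ht.2
  have hwin : ∀ s ∈ Ico t T, s ∈ Ioo 0 T ∧ 1 ≤ Zr s := fun s hs => ht₁ ⟨ht.1.trans_le hs.1, hs.2⟩
  have htI : t ∈ Ioo 0 T := (hwin t ⟨le_rfl, htT⟩).1
  have hZt : 0 < Zr t := one_pos.trans_le (hwin t ⟨le_rfl, htT⟩).2
  -- `G = −Z⁻²`, `f = G' = 2Ż/Z³ ≤ M = 27c⁴/(64ν³)`
  set G : ℝ → ℝ := fun s => -((Zr s)⁻¹ ^ 2) with hG
  set f : ℝ → ℝ := fun s => 2 * (2 * Sr s - 2 * ν * Pr s) / Zr s ^ 3 with hf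
  set M : ℝ := 27 * c ^ 4 / (64 * ν ^ 3) with hM
  have hM0 : 0 < M := by positivity
  have hder : ∀ s ∈ Ico t T, HasDerivAt G (f s) s := by
    intro s hs
    have hZs : Zr s ≠ 0 := (one_pos.trans_le (hwin s hs).2).ne'
    have h := (ProductionEfficiencyDecay.hasDerivAt_inv_sq (hZ s (hwin s hs).1).2.2.2.2.2.1 hZs).neg
    refine h.congr_deriv ?_
    simp only [hf]
    ring
  have hfM : ∀ s ∈ Ico t T, f s ≤ M := by
    intro s hs
    obtain ⟨-, hZ0, hP0, -, -, -, henv⟩ := hZ s (hwin s hs).1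
    have hZs : 0 < Zr s := one_pos.trans_le (hwin s hs).2
    have hZ3 : 0 < Zr s ^ 3 := pow_pos hZs 3
    have hcl := cubic_law hc hν hZ0 hP0 henv
    simp only [hf, hM]
    rw [div_le_iff₀ hZ3]
    have : 27 * c ^ 4 / (64 * ν ^ 3) * Zr s ^ 3 = 2 * (27 * c ^ 4 / (128 * ν ^ 3) * Zr s ^ 3) := by
      ring
    rw [this]
    linarith
  -- `G` gets above `−η` (blow-up of `Z`)
  have hsup : ∀ η : ℝ, 0 < η → ∃ T' ∈ Ioo t T, -η ≤ G T' := by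
    intro η hη
    set N : ℝ := 1 / Real.sqrt η with hN
    have hNpos : 0 < N := by positivity
    obtain ⟨T', ⟨-, hNT'⟩, hT'⟩ :=
      ((eventually_le_Zr hν hT hmax hLH hdec (fun t ht => (hZ t ht).1) (fun t ht => (hZ t ht).2.1)
        N).and (Ioo_mem_nhdsLT htT)).exists
    refine ⟨T', hT', ?_⟩
    have hZT' : 0 < Zr T' := hNpos.trans_le hNT'
    have h1 : (Zr T')⁻¹ ≤ Real.sqrt η := by
      have := inv_anti₀ hNpos hNT'
      rwa [hN, one_div, inv_inv] at this
    have h2 : (Zr T')⁻¹ ^ 2 ≤ η := by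
      calc (Zr T')⁻¹ ^ 2 ≤ Real.sqrt η ^ 2 := pow_le_pow_left₀ (inv_nonneg.2 hZT'.le) h1 2
        _ = η := Real.sq_sqrt hη.le
    simp only [hG]
    linarith
  -- the measure lemma with `λ = 1/(2W²)`
  have hW2 : 0 < W ^ 2 := pow_pos hW 2
  have hmeas := measure_growthSet_ge (lam := 1 / (2 * W ^ 2)) hder hfM hM0 (by positivity) hsup
  -- `−G(t) = Z(t)⁻² ≥ (T−t)/W²`
  have hTt : 0 < T - t := sub_pos.2 htT
  have hZle : Zr t ≤ W / Real.sqrt (T - t) := by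
    have h := hbound
    rw [(hZ t htI).1] at h
    exact (ENNReal.ofReal_le_ofReal_iff (by positivity)).1 h
  have hGt : (T - t) / W ^ 2 ≤ -G t := by
    have h1 : Zr t ^ 2 ≤ W ^ 2 / (T - t) := by
      calc Zr t ^ 2 ≤ (W / Real.sqrt (T - t)) ^ 2 := pow_le_pow_left₀ hZt.le hZle 2
        _ = W ^ 2 / (T - t) := by rw [div_pow, Real.sq_sqrt hTt.le]
    have h2 : (W ^ 2 / (T - t))⁻¹ ≤ (Zr t ^ 2)⁻¹ := inv_anti₀ (pow_pos hZt 2) h1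
    rw [inv_div] at h2
    simpa only [hG, inv_pow, neg_neg] using h2
  -- compare the constants and the sets
  have hκ : 32 * ν ^ 3 / (27 * c ^ 4 * W ^ 2) * (T - t) ≤ (-G t - 1 / (2 * W ^ 2) * (T - t)) / M := by
    rw [le_div_iff₀ hM0]
    have h1 : 32 * ν ^ 3 / (27 * c ^ 4 * W ^ 2) * (T - t) * M = (T - t) / (2 * W ^ 2) := by
      simp only [hM]
      field_simp
      ring
    rw [h1]
    have h2 : (T - t) / (2 * W ^ 2) + 1 / (2 * W ^ 2) * (T - t) = (T - t) / W ^ 2 := by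
      field_simp
      ring
    linarith
  refine ((ENNReal.ofReal_le_ofReal hκ).trans hmeas).trans (measure_mono ?_)
  rintro s ⟨hs, hle⟩
  have hsI : s ∈ Ico t T := ⟨hs.1.le, hs.2⟩
  have hZs : 0 < Zr s := one_pos.trans_le (hwin s hsI).2
  have hZ3 : 0 < Zr s ^ 3 := pow_pos hZs 3
  refine ⟨hs, hZs, ?_⟩
  simp only [hf] at hle
  rw [le_div_iff₀ hZ3] at hle
  rw [div_le_iff₀ (by positivity : (0:ℝ) < 4 * W ^ 2)]
  have h4 : 1 / (2 * W ^ 2) * Zr s ^ 3 * (4 * W ^ 2) = 2 * Zr s ^ 3 := by field_simp; ring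
  nlinarith [hle, h4, hZ3, hW2]

/-- **Density of concentrated near-extremal states under a Type-I enstrophy bound.** For every
`ν, W > 0` there are `δ₀, R₀, κ > 0` such that along every maximal smooth Leray–Hopf rapidly-decaying-datum
solution on `[0,T)`: eventually, at every time `t` with `Z(t) ≤ W/√(T−t)`, the later times `s ∈ (t,T)` at
which a `δ₀`-fraction of the enstrophy sits in one ball of radius `R₀/Z(s)` have measure at least
`κ·(T − t)`. A structure statement about a hypothetical blow-up; nothing about NS regularity is asserted.
[folklore] -/
theorem density_concentrated : ∀ (ν W : ℝ), 0 < ν → 0 < W → ∃ δ₀ R₀ κ : ℝ, 0 < δ₀ ∧ 0 < R₀ ∧ 0 < κ ∧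
    ∀ (T : ℝ), 0 < T →
    ∀ (u : ℝ → EuclideanSpace ℝ (Fin 3) → EuclideanSpace ℝ (Fin 3))
      (p : ℝ → EuclideanSpace ℝ (Fin 3) → ℝ),
      IsMaximalSmoothSolution ν 0 u p T → IsLerayHopfOn T ν 0 (u 0) u → HasRapidSpatialDecay (u 0) →
      ∀ᶠ t in 𝓝[<] T, ∫⁻ x, ‖curl (u t) x‖ₑ ^ 2 ≤ ENNReal.ofReal (W / Real.sqrt (T - t)) →
        ENNReal.ofReal (κ * (T - t)) ≤
          volume {s | s ∈ Ioo t T ∧ 0 < ∫ x, ‖curl (u s) x‖ ^ 2 ∧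
            ∃ a : EuclideanSpace ℝ (Fin 3), δ₀ * ∫ x, ‖curl (u s) x‖ ^ 2 ≤
              ∫ x in Metric.ball a (R₀ / ∫ x, ‖curl (u s) x‖ ^ 2), ‖curl (u s) x‖ ^ 2} := by
  obtain ⟨c, hc, hB⟩ := EnstrophyBudget.main
  intro ν W hν hW
  obtain ⟨ε₀, hε₀⟩ : ∃ ε₀ : ℝ, ε₀ = 1 / (4 * W ^ 2) := ⟨_, rfl⟩
  have hε₀pos : 0 < ε₀ := by rw [hε₀]; positivity
  obtain ⟨K, δ, hK, hδ, hS5⟩ :=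
    ProductionEfficiencyDecay.stub_efficiencyConcentration (ε₀ * ν ^ 3 / (2 * c ^ 3)) (by positivity)
  have hApos : 0 < (2 * c / ε₀) ^ (4 / 3 : ℝ) := Real.rpow_pos_of_pos (by positivity) _
  refine ⟨δ, K * Real.sqrt ((2 * c / ε₀) ^ (4 / 3 : ℝ)), 32 * ν ^ 3 / (27 * c ^ 4 * W ^ 2), hδ,
    mul_pos hK (Real.sqrt_pos.2 hApos), by positivity, ?_⟩
  intro T hT u p hmax hLH hdec
  obtain ⟨Zr, Pr, Sr, hZ⟩ := hB ν T hν hT u p hmax hLH hdec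
  filter_upwards [density hν hT hmax hLH hdec hc hZ hW, Ioo_mem_nhdsLT hT] with t ht ht0 hbound
  refine (ht hbound).trans (measure_mono ?_)
  rintro s ⟨hs, hZs, hgrow⟩
  have hsI : s ∈ Ioo 0 T := ⟨ht0.1.trans hs.1, hs.2⟩
  obtain ⟨hZeq, -, hP0, hPeq, hSeq, -, henv⟩ := hZ s hsI
  have hgrow' : ε₀ * Zr s ^ 3 ≤ 2 * Sr s - 2 * ν * Pr s := by
    have : ε₀ * Zr s ^ 3 = Zr s ^ 3 / (4 * W ^ 2) := by rw [hε₀]; ring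
    rw [this]; exact hgrow
  exact ⟨hs, concentrated_of_growth hν hT hmax hLH hdec hc hε₀pos hK hS5 hsI hZeq hZs hP0 hPeq hSeq henv
    hgrow'⟩

/-- **Under the quarter law** `Z(t) ≤ K/√(T−t)` on `[0,T)` (the conclusion of the route's residual
`EnstrophyQuarterLaw`, stmt-1574, for this solution): with the constants `δ₀, R₀, κ` of
`density_concentrated` at `W = max K 1`, EVERY late time `t` sees concentrated near-extremal states on a
set of later times of measure `≥ κ(T − t)` — a blow-up at Leray's enstrophy rate rides the Lu–Doering
extremal configurations on a fixed fraction of every late time interval. Nothing about NS regularity is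
asserted. [folklore] -/
theorem density_of_quarterLaw {ν K : ℝ} (hν : 0 < ν) :
    ∃ δ₀ R₀ κ : ℝ, 0 < δ₀ ∧ 0 < R₀ ∧ 0 < κ ∧ ∀ (T : ℝ), 0 < T →
    ∀ (u : ℝ → EuclideanSpace ℝ (Fin 3) → EuclideanSpace ℝ (Fin 3))
      (p : ℝ → EuclideanSpace ℝ (Fin 3) → ℝ),
      IsMaximalSmoothSolution ν 0 u p T → IsLerayHopfOn T ν 0 (u 0) u → HasRapidSpatialDecay (u 0) →
      (∀ t ∈ Ico 0 T, ∫⁻ x, ‖curl (u t) x‖ₑ ^ 2 ≤ ENNReal.ofReal (K / Real.sqrt (T - t))) →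
      ∀ᶠ t in 𝓝[<] T, ENNReal.ofReal (κ * (T - t)) ≤
          volume {s | s ∈ Ioo t T ∧ 0 < ∫ x, ‖curl (u s) x‖ ^ 2 ∧
            ∃ a : EuclideanSpace ℝ (Fin 3), δ₀ * ∫ x, ‖curl (u s) x‖ ^ 2 ≤
              ∫ x in Metric.ball a (R₀ / ∫ x, ‖curl (u s) x‖ ^ 2), ‖curl (u s) x‖ ^ 2} := by
  obtain ⟨δ₀, R₀, κ, hδ₀, hR₀, hκ, h⟩ := density_concentrated ν (max K 1) hν (lt_max_of_lt_right one_pos)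
  refine ⟨δ₀, R₀, κ, hδ₀, hR₀, hκ, fun T hT u p hmax hLH hdec hq => ?_⟩
  filter_upwards [h T hT u p hmax hLH hdec, Ico_mem_nhdsLT hT] with t ht htI
  refine ht ((hq t htI).trans (ENNReal.ofReal_le_ofReal ?_))
  exact div_le_div_of_nonneg_right (le_max_left _ _) (Real.sqrt_nonneg _)

/-! ## 3. The contrapositive: sparse growth gives the super-Leray floor -/

/-- **Sparse growth ⇒ the super-Leray floor** (contrapositive of `density`). If, for every `W > 0`,
eventually the growth instants `Z³/(4W²) ≤ Ż` in `(t,T)` occupy LESS than the fraction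
`32ν³/(27c⁴W²)` of the remaining lifetime, then `Z(t)√(T−t) → ∞`: for every `K`, eventually
`K/√(T−t) < Z(t)` — the conclusion of the route's `FloorOfEfficiencyDecay` for this solution, obtained
WITHOUT the pointwise crux `ProductionEfficiencyDecay`. [folklore] -/
theorem floor_of_sparseGrowth (hν : 0 < ν) (hT : 0 < T) (hmax : IsMaximalSmoothSolution ν 0 u p T)
    (hLH : IsLerayHopfOn T ν 0 (u 0) u) (hdec : HasRapidSpatialDecay (u 0)) {c : ℝ} (hc : 0 < c)
    {Zr Pr Sr : ℝ → ℝ}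
    (hZ : ∀ t ∈ Set.Ioo 0 T,
      ∫⁻ x, ‖curl (u t) x‖ₑ ^ 2 = ENNReal.ofReal (Zr t) ∧ 0 ≤ Zr t ∧ 0 ≤ Pr t ∧
      Pr t = ∫ x, frobeniusNormSq (fderiv ℝ (curl (u t)) x) ∧
      Sr t = ∫ x, ⟪curl (u t) x, fderiv ℝ (u t) x (curl (u t) x)⟫_ℝ ∧
      HasDerivAt Zr (2 * Sr t - 2 * ν * Pr t) t ∧
      |Sr t| ≤ c * Zr t ^ (3 / 4 : ℝ) * Pr t ^ (3 / 4 : ℝ))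
    (hsparse : ∀ W : ℝ, 0 < W → ∀ᶠ t in 𝓝[<] T,
      volume {s | s ∈ Ioo t T ∧ 0 < Zr s ∧ Zr s ^ 3 / (4 * W ^ 2) ≤ 2 * Sr s - 2 * ν * Pr s} <
        ENNReal.ofReal (32 * ν ^ 3 / (27 * c ^ 4 * W ^ 2) * (T - t)))
    (K : ℝ) : ∀ᶠ t in 𝓝[<] T, ENNReal.ofReal (K / Real.sqrt (T - t)) < ∫⁻ x, ‖curl (u t) x‖ₑ ^ 2 := by
  by_cases hK : K ≤ 0
  · filter_upwards [eventually_le_Zr hν hT hmax hLH hdec (fun t ht => (hZ t ht).1)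
      (fun t ht => (hZ t ht).2.1) 1] with t ht
    rw [ENNReal.ofReal_of_nonpos (div_nonpos_of_nonpos_of_nonneg hK (Real.sqrt_nonneg _)),
      (hZ t ht.1).1, ENNReal.ofReal_pos]
    linarith [ht.2]
  rw [not_le] at hK
  filter_upwards [density hν hT hmax hLH hdec hc hZ hK, hsparse K hK] with t hdens hsp
  exact not_le.1 fun hle => (lt_irrefl _) ((hdens hle).trans_lt hsp)

/-- **Vanishing growth density ⇒ the super-Leray floor**, intrinsic form. With the real enstrophy
`Z(t) = (∫⁻|curl u(t)|²).toReal` and its derivative `Ż = deriv Z`: if for every `W, κ > 0`, eventually the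
instants `s ∈ (t,T)` with `Z(s)³/(4W²) ≤ Ż(s)` have measure `≤ κ(T−t)`, then for every `K`, eventually
`K/√(T−t) < Z(t)`. This 'VANISHING GROWTH DENSITY' statement is implied by the crux
`ProductionEfficiencyDecay` (which empties the growth sets) and implies what the route's deciding theorem
consumes (the floor); it is still refuted by any Leray-rate blow-up, hence open-problem grade — but it is the
mechanism-level (sparseness) form an exit estimate would deliver. [folklore] -/
theorem floor_of_vanishingGrowthDensity (hν : 0 < ν) (hT : 0 < T)
    (hmax : IsMaximalSmoothSolution ν 0 u p T) (hLH : IsLerayHopfOn T ν 0 (u 0) u)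
    (hdec : HasRapidSpatialDecay (u 0))
    (hVGD : ∀ W : ℝ, 0 < W → ∀ κ : ℝ, 0 < κ → ∀ᶠ t in 𝓝[<] T,
      volume {s | s ∈ Ioo t T ∧
        (∫⁻ x, ‖curl (u s) x‖ₑ ^ 2).toReal ^ 3 / (4 * W ^ 2) ≤
          deriv (fun r => (∫⁻ x, ‖curl (u r) x‖ₑ ^ 2).toReal) s} ≤ ENNReal.ofReal (κ * (T - t)))
    (K : ℝ) : ∀ᶠ t in 𝓝[<] T, ENNReal.ofReal (K / Real.sqrt (T - t)) < ∫⁻ x, ‖curl (u t) x‖ₑ ^ 2 := by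
  obtain ⟨c, hc, hB⟩ := EnstrophyBudget.main
  obtain ⟨Zr, Pr, Sr, hZ⟩ := hB ν T hν hT u p hmax hLH hdec
  -- the intrinsic enstrophy agrees with `Zr` on `(0,T)`, with derivative `2S − 2ν·Pal`
  have hZfun : ∀ s ∈ Ioo 0 T, (∫⁻ x, ‖curl (u s) x‖ₑ ^ 2).toReal = Zr s := fun s hs => by
    rw [(hZ s hs).1, ENNReal.toReal_ofReal (hZ s hs).2.1]
  have hderiv : ∀ s ∈ Ioo 0 T,
      deriv (fun r => (∫⁻ x, ‖curl (u r) x‖ₑ ^ 2).toReal) s = 2 * Sr s - 2 * ν * Pr s := by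
    intro s hs
    have heq : (fun r => (∫⁻ x, ‖curl (u r) x‖ₑ ^ 2).toReal) =ᶠ[𝓝 s] Zr :=
      Filter.eventuallyEq_of_mem (Ioo_mem_nhds hs.1 hs.2) fun r hr => hZfun r hr
    rw [heq.deriv_eq, (hZ s hs).2.2.2.2.2.1.deriv]
  refine floor_of_sparseGrowth hν hT hmax hLH hdec hc hZ (fun W hW => ?_) K
  have hκ : (0:ℝ) < 32 * ν ^ 3 / (27 * c ^ 4 * W ^ 2) / 2 := by positivity
  filter_upwards [hVGD W hW _ hκ, Ioo_mem_nhdsLT hT] with t ht ht0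
  have hTt : 0 < T - t := sub_pos.2 ht0.2
  refine lt_of_le_of_lt ((measure_mono ?_).trans ht) (ENNReal.ofReal_lt_ofReal_iff'.2 ⟨?_, ?_⟩)
  · rintro s ⟨hs, -, hgrow⟩
    have hsI : s ∈ Ioo 0 T := ⟨ht0.1.trans hs.1, hs.2⟩
    refine ⟨hs, ?_⟩
    rw [hZfun s hsI, hderiv s hsI]
    exact hgrow
  · nlinarith
  · positivity

/-- **A deciding theorem for the weaker crux.** Vanishing growth density along every maximal smooth
Leray–Hopf rapidly-decaying-datum solution (the intrinsic statement of `floor_of_vanishingGrowthDensity`),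
together with the route's residual `EnstrophyQuarterLaw` (stmt-1574), gives `NavierStokesRegularity` — by the
same pincer as the route's `closes` (floor against the quarter-law ceiling, then stmt-0055). Both hypotheses
are OPEN (each excludes a class of blow-ups); NS regularity is NOT proved by this conditional. [folklore] -/
theorem navierStokesRegularity_of_vanishingGrowthDensity_of_quarterLaw
    (hV : ∀ (ν T : ℝ), 0 < ν → 0 < T →
      ∀ (u : ℝ → EuclideanSpace ℝ (Fin 3) → EuclideanSpace ℝ (Fin 3))
        (p : ℝ → EuclideanSpace ℝ (Fin 3) → ℝ),
        IsMaximalSmoothSolution ν 0 u p T → IsLerayHopfOn T ν 0 (u 0) u → HasRapidSpatialDecay (u 0) →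
        ∀ W : ℝ, 0 < W → ∀ κ : ℝ, 0 < κ → ∀ᶠ t in 𝓝[<] T,
          volume {s | s ∈ Ioo t T ∧
            (∫⁻ x, ‖curl (u s) x‖ₑ ^ 2).toReal ^ 3 / (4 * W ^ 2) ≤
              deriv (fun r => (∫⁻ x, ‖curl (u r) x‖ₑ ^ 2).toReal) s} ≤ ENNReal.ofReal (κ * (T - t)))
    (hQ : Summit.NavierStokesRegularity.NavierStokesRegularity.Theses.EfficiencyFloor.EnstrophyQuarterLaw) :
    _root_.NavierStokesRegularity := by
  apply Summit.NavierStokesRegularity.NavierStokesRegularity.Theorems.navierStokesRegularity_of_noBlowup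
  intro ν T hν hT0 u p hcl hLH hdec
  by_contra hext
  have hmax : IsMaximalSmoothSolution ν 0 u p T := ⟨hcl, hext⟩
  obtain ⟨K, hK⟩ := hQ ν T hν hT0 u p hmax hLH hdec
  have hSL := floor_of_vanishingGrowthDensity hν hT0 hmax hLH hdec (hV ν T hν hT0 u p hmax hLH hdec) K
  obtain ⟨t, ht, htI⟩ := (hSL.and (Ico_mem_nhdsLT hT0)).exists
  exact absurd (hK t htI) (not_le.2 ht)

end TypeIRecurrence

end Summit.NavierStokesRegularity.NavierStokesRegularity.Theorems

end
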